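import Literature.FieldTheory.ReducedFiniteAlgebraPiFields                       -- ★ p851652 `exists_algEquiv_pi_intermediateField` (reduced f.d. algebra ≃ ∏ fields)
import Literature.NumberTheory.LocalFields.SquareClassesFiniteLocallyCompact       -- ★ p851640 (B1) `exists_finset_forall_eq_mul_sq` (square classes of a locally compact field)
import Literature.NumberTheory.GaloisRepresentations.LocalFieldFiniteExtension     -- ★ `FiniteExtension.normedField ∕ completeSpace ∕ locallyCompactSpace`
import HarnessLib

/-!
# Square classes of the units of a finite étale algebra over a non-archimedean local field of characteristic zero are FINITE

Topic `NumberTheory/LocalFields`; namespace `Literature.NumberTheory.LocalFields`.  THEOREMS ONLY (no `def`, no named fact, no instance,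
no notation, no `sorry`).  Cell `pub/hodgecm-mathlib`, FLOOR 0, crux H413 = stmt-HodgeConjecture-24833, in-house road CARTAN-FIN (N1)
(road owner F0P3a-p03 (g24), DEAL #1 2026-09-02T14:15:06Z), brick **(B6) «ETALE-UNIT-SQUARE-CLASSES-FIN»**, prover F0P2-p01 (g22); head token for token
as dealt.  Count-neutral; HC_CM is proved only modulo the printed citations until rung 0 closes.

Let `F` be a non-archimedean local field of characteristic zero (Mathlib `IsNonarchimedeanLocalField`, `CharZero`) and `K` a reduced finite-dimensional
commutative `F`-algebra (a finite étale `F`-algebra: a finite product of finite separable extensions of `F`).  Then `Kˣ ∕ Kˣ²` is FINITE: there is a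
finite set `T ⊆ Kˣ` with every unit of the form `t · c²`, `t ∈ T`.  Proof: `K ≃ₐ[F] ∏_{i<k} E_i` with `E_i` finite extensions of `F` (★
`Literature.FieldTheory.exists_algEquiv_pi_intermediateField`, the structure theorem for reduced Artin rings [AtiyahMacdonald1969, Thm. 8.7], factors
realised inside `AlgebraicClosure F`); `Kˣ ≃* ∏ E_iˣ` (`Units.mapEquiv`, `MulEquiv.piUnits`); each `E_i` is a complete locally compact nontrivially normed
field for the extended absolute value (★ `FiniteExtension.normedField ∕ completeSpace ∕ locallyCompactSpace` [SerreLocalFields1979, Ch. II §2 Prop. 3]) with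
`2 ≠ 0` (characteristic zero), so `E_iˣ ∕ E_iˣ²` is finite (★ (B1) `exists_finset_forall_eq_mul_sq` [NeukirchANT1999, Ch. II (5.8) Cor.]); the product
of the finite sets of representatives represents `Kˣ ∕ Kˣ²`.

* `exists_finset_forall_eq_mul_sq_pi` — the product step for an arbitrary finite family of commutative monoids... stated for groups of units of
  commutative rings: square-class representatives factorwise ⇒ square-class representatives of `(∏ R_i)ˣ`.
* **`exists_finset_units_forall_eq_mul_sq`** — THE HEAD (as dealt).
* `finiteIndex_range_powMonoidHom_two_units`, `finite_unitsModSquares` — the `FiniteIndex` ∕ `Finite (Kˣ ⧸ Kˣ²)` readings.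

Consumer (road (B7a), F0P3a-p03): for a regular semisimple `γ` in a unitary group the stable-versus-rational Cartan obstruction lives in
`(L[γ]^⋆)ˣ ∕ {a⋆ a}` with `L[γ]^⋆` a finite étale algebra over the local field `L⁺_v`; since `a⋆ a = a²` on `L[γ]^⋆` the norm classes are coarser than
the square classes, so this file bounds them [Rogawski1990, §3.5 Prop. 3.5.2, §3.6].

## References
* [NeukirchANT1999] J. Neukirch, *Algebraic Number Theory* (1999), Ch. II (5.7)–(5.8) and Cor. (`Kˣ ∕ Kˣⁿ` finite for a local field of characteristic `0`).
* [AtiyahMacdonald1969] M. Atiyah, I. Macdonald, *Introduction to Commutative Algebra* (1969), Thm. 8.7 (structure of Artin rings).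
* [SerreLocalFields1979] J.-P. Serre, *Local Fields* (1979), Ch. II §2 Prop. 3, Cor. 2 (finite extensions of complete fields).
* [Rogawski1990] J. D. Rogawski, *Automorphic Representations of Unitary Groups in Three Variables* (1990), §3.5–§3.6 (the consumer).
-/

set_option autoImplicit false

noncomputable section

namespace Literature.NumberTheory.LocalFields

open Literature.NumberTheory.GaloisRepresentations

/-! ## §1 The product step -/

/-- **Square-class representatives of a finite product of unit groups**: if every factor `(R i)ˣ` has a finite set of square-class representatives,
so does `(∏ i, R i)ˣ` (the product of the sets, read through `MulEquiv.piUnits`). [cite: NeukirchANT1999, Ch. II (5.8) Cor.] -/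
theorem exists_finset_forall_eq_mul_sq_pi {ι : Type} [Fintype ι] [DecidableEq ι] (R : ι → Type) [∀ i, Monoid (R i)]
    (h : ∀ i, ∃ T : Finset (R i)ˣ, ∀ x : (R i)ˣ, ∃ t ∈ T, ∃ c : (R i)ˣ, x = t * c ^ 2) :
    ∃ T : Finset (∀ i, R i)ˣ, ∀ x : (∀ i, R i)ˣ, ∃ t ∈ T, ∃ c : (∀ i, R i)ˣ, x = t * c ^ 2 := by
  classical
  choose T hT using h
  refine ⟨(Fintype.piFinset T).image fun t => MulEquiv.piUnits.symm t, fun x => ?_⟩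
  have hx : ∀ i, ∃ a ∈ T i, ∃ c : (R i)ˣ, MulEquiv.piUnits x i = a * c ^ 2 := fun i => hT i (MulEquiv.piUnits x i)
  choose a ha c hc using hx
  refine ⟨MulEquiv.piUnits.symm a, Finset.mem_image.mpr ⟨a, Fintype.mem_piFinset.mpr ha, rfl⟩, MulEquiv.piUnits.symm c, ?_⟩
  apply MulEquiv.piUnits.injective
  rw [map_mul, map_pow, MulEquiv.apply_symm_apply, MulEquiv.apply_symm_apply]
  funext i
  rw [Pi.mul_apply, Pi.pow_apply]
  exact hc i

/-- **Transport of square-class representatives along a multiplicative equivalence** (private plumbing). [folklore] -/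
private theorem exists_finset_forall_eq_mul_sq_of_mulEquiv {M N : Type} [Monoid M] [Monoid N] (e : Mˣ ≃* Nˣ)
    (h : ∃ T : Finset Nˣ, ∀ x : Nˣ, ∃ t ∈ T, ∃ c : Nˣ, x = t * c ^ 2) :
    ∃ T : Finset Mˣ, ∀ x : Mˣ, ∃ t ∈ T, ∃ c : Mˣ, x = t * c ^ 2 := by
  classical
  obtain ⟨T, hT⟩ := h
  refine ⟨T.image fun t => e.symm t, fun x => ?_⟩
  obtain ⟨t, ht, c, hc⟩ := hT (e x)
  refine ⟨e.symm t, Finset.mem_image.mpr ⟨t, ht, rfl⟩, e.symm c, e.injective ?_⟩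
  rw [map_mul, map_pow, MulEquiv.apply_symm_apply, MulEquiv.apply_symm_apply, hc]

/-! ## §2 One factor: a finite extension of the local field -/

/-- **A finite extension of a non-archimedean local field of characteristic zero has finitely many square classes**: `E` (a field, finite-dimensional
over `F`) is complete and locally compact for the extended absolute value (★ `FiniteExtension.normedField ∕ completeSpace ∕ locallyCompactSpace`) and
`(2 : E) ≠ 0`, so ★ (B1) `exists_finset_forall_eq_mul_sq` applies. [cite: NeukirchANT1999, Ch. II (5.8) Cor.] [cite: SerreLocalFields1979, Ch. II §2 Prop. 3] -/
theorem exists_finset_forall_eq_mul_sq_finiteExtension (F : Type) [Field F] [ValuativeRel F] [TopologicalSpace F] [IsNonarchimedeanLocalField F]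
    [CharZero F] (E : Type) [Field E] [Algebra F E] [FiniteDimensional F E] :
    ∃ T : Finset Eˣ, ∀ x : Eˣ, ∃ t ∈ T, ∃ c : Eˣ, x = t * c ^ 2 := by
  letI := FiniteExtension.normedField F E
  haveI : CompleteSpace E := FiniteExtension.completeSpace F E
  haveI : LocallyCompactSpace E := FiniteExtension.locallyCompactSpace F E
  haveI : CharZero E := charZero_of_injective_algebraMap (algebraMap F E).injective
  exact exists_finset_forall_eq_mul_sq (E := E) two_ne_zero

/-! ## §3 The head: finite étale algebras -/

/-- **(B6) «ETALE-UNIT-SQUARE-CLASSES-FIN».**  For a non-archimedean local field `F` of characteristic zero and a reduced finite-dimensional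
commutative `F`-algebra `K`, the square classes `Kˣ ∕ Kˣ²` are FINITE: some finite `T ⊆ Kˣ` has `∀ x : Kˣ, ∃ t ∈ T, ∃ c, x = t · c²`
(`K ≃ₐ[F] ∏ E_i` by ★ `exists_algEquiv_pi_intermediateField`; factorwise §2; product §1). [cite: NeukirchANT1999, Ch. II (5.8) Cor.]
[cite: AtiyahMacdonald1969, Thm 8.7] -/
theorem exists_finset_units_forall_eq_mul_sq (F : Type) [Field F] [ValuativeRel F] [TopologicalSpace F] [IsNonarchimedeanLocalField F]
    [CharZero F] (K : Type) [CommRing K] [Algebra F K] [IsReduced K] [FiniteDimensional F K] :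
    ∃ T : Finset Kˣ, ∀ x : Kˣ, ∃ t ∈ T, ∃ c : Kˣ, x = t * c ^ 2 := by
  classical
  obtain ⟨k, E, -, hE, ⟨e⟩⟩ := Literature.FieldTheory.exists_algEquiv_pi_intermediateField F K (AlgebraicClosure F)
  have hfac : ∀ i : Fin k, ∃ T : Finset (E i)ˣ, ∀ x : (E i)ˣ, ∃ t ∈ T, ∃ c : (E i)ˣ, x = t * c ^ 2 := fun i => by
    haveI : FiniteDimensional F (E i) := (hE i).1
    exact exists_finset_forall_eq_mul_sq_finiteExtension F (E i)
  exact exists_finset_forall_eq_mul_sq_of_mulEquiv (Units.mapEquiv e.toMulEquiv)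
    (exists_finset_forall_eq_mul_sq_pi (fun i => (E i : Type)) hfac)

/-- **`Kˣ ∕ Kˣ²` has finite index**: the subgroup of squares `range (powMonoidHom 2)` of the units of a finite étale algebra over a characteristic-zero
non-archimedean local field has finite index. [cite: NeukirchANT1999, Ch. II (5.8) Cor.] -/
theorem finiteIndex_range_powMonoidHom_two_units (F : Type) [Field F] [ValuativeRel F] [TopologicalSpace F] [IsNonarchimedeanLocalField F]
    [CharZero F] (K : Type) [CommRing K] [Algebra F K] [IsReduced K] [FiniteDimensional F K] :
    ((powMonoidHom 2 : Kˣ →* Kˣ).range).FiniteIndex := by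
  classical
  obtain ⟨T, hT⟩ := exists_finset_units_forall_eq_mul_sq F K
  haveI : Finite (Kˣ ⧸ (powMonoidHom 2 : Kˣ →* Kˣ).range) := by
    refine Finite.of_surjective (fun a : (T : Set Kˣ) => (QuotientGroup.mk (a : Kˣ) : Kˣ ⧸ (powMonoidHom 2 : Kˣ →* Kˣ).range)) ?_
    intro q
    induction q using QuotientGroup.induction_on with
    | H x =>
      obtain ⟨a, haT, c, hx⟩ := hT x
      refine ⟨⟨a, haT⟩, ?_⟩
      rw [QuotientGroup.eq]
      refine ⟨c, ?_⟩
      rw [powMonoidHom_apply, hx, ← mul_assoc, inv_mul_cancel, one_mul]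
  exact Subgroup.finiteIndex_of_finite_quotient

/-- **`Kˣ ∕ Kˣ²` is a finite type** (finite étale `K` over a characteristic-zero non-archimedean local field). [cite: NeukirchANT1999, Ch. II (5.8) Cor.] -/
theorem finite_units_quotient_range_powMonoidHom_two (F : Type) [Field F] [ValuativeRel F] [TopologicalSpace F] [IsNonarchimedeanLocalField F]
    [CharZero F] (K : Type) [CommRing K] [Algebra F K] [IsReduced K] [FiniteDimensional F K] :
    Finite (Kˣ ⧸ (powMonoidHom 2 : Kˣ →* Kˣ).range) := by
  haveI := finiteIndex_range_powMonoidHom_two_units F K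
  exact Subgroup.finite_quotient_of_finiteIndex

end Literature.NumberTheory.LocalFields

end
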